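import Summits.PneNP.PneNP.Theorems.ConvexRankGatesCaptureDefs
import Literature.Computability.Complexity.CircuitComposition
import Mathlib.Data.Fintype.Sigma
import Mathlib.Data.Fintype.BigOperators
import Mathlib.Data.Finset.Sort
import HarnessLib

-- progress log (worker S1): [1] defs + soundness compile; [2] full file rc 0, 0 sorries, no
-- warnings; [3] Defs p76018 ACCEPTED, imported; proposing --supports stmt-PneNP-2659.

/-!
# Route ConvexRankGates, crux `Capture` (stmt-PneNP-2659), line `csp-spine-meet-to-join`: stub `stub_consistencyUnrolls`

**Local consistency unrolls** (stratum 1 of the CSP spine): an LC gate of size parameter `s`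
(`IsLCGate s g`: the gate fires on a selection `v` of constraints iff `k`-consistency refutes the
selected instance, `∀ h, KInconsistent nv nd k U R v ∅ h`) is computed by a `{∧₂, ∨₂, 1, 0}`-circuit
(`monConst`) with `≤ (s + 2) ^ 10` gates. Proof: the derivable facts `(W, h|_W)`, `|W| ≤ k`, form the
least fixed point of a monotone inflationary ROUND operator on valuations of the `≤ s²` facts
(`LCFact`); a round is an `∨` of input wires (`viol`), of `∧`s over values of fresh variables (`ext`)
and of sub-facts (`mono`/`congr`), i.e. `poly(s)` binary gates (`lc_stepCkt`); `|LCFact|` rounds from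
the empty valuation reach the fixed point (`lc_iterate_fix`), which is exactly derivability
(`lc_sound`, `lc_complete`); unroll with `CktSize.iterate` (Datalog queries have polynomial monotone
circuits, Afrati–Cosmadakis–Yannakakis 1995).
-/

namespace Summit.PneNP.PneNP.Cruxes.Capture.CspSpineMeetToJoin

set_option linter.dupNamespace false

open Finset Literature.Computability.Complexity

/-! ## Small circuits over `{∧₂, ∨₂, 1, 0}` -/

/-- `∧₂ ∈ {∧₂, ∨₂, 1, 0}`. -/
theorem lc_mem_and : GateFn.and 2 ∈ monConst := by simp [monConst]

/-- `∨₂ ∈ {∧₂, ∨₂, 1, 0}`. -/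
theorem lc_mem_or : GateFn.or 2 ∈ monConst := by simp [monConst]

/-- The constants are in `{∧₂, ∨₂, 1, 0}`. -/
theorem lc_mem_const (b : Bool) : GateFn.const b ∈ monConst := by cases b <;> simp [monConst]

/-- A constant costs one gate over `monConst`. -/
theorem lc_cktSize_const (ι : Type*) (b : Bool) :
    CktSize monConst (fun (_ : ι → Bool) (_ : Unit) => b) 1 :=
  (CktSize.gate (B := monConst) (ι := ι) (GateFn.const b) (lc_mem_const b) Fin.elim0).congr
    fun _ _ => rfl

/-- The disjunction of `n` given wires costs `n + 1` gates over `monConst` (fold of `∨₂` from `0`). -/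
theorem lc_orFin {ι : Type*} : ∀ (n : ℕ) (w : Fin n → ι),
    CktSize monConst (fun (x : ι → Bool) (_ : Unit) => decide (∃ a, x (w a) = true)) (n + 1)
  | 0, w => (lc_cktSize_const ι false).congr fun x _ => by simp
  | n + 1, w => by
    have h1 := (CktSize.id monConst).pair (lc_orFin n fun a => w a.succ)
    have h2 := CktSize.gate (B := monConst) (ι := ι ⊕ Unit) (GateFn.or 2) lc_mem_or
      ![Sum.inl (w 0), Sum.inr ()]
    refine ((h1.comp h2).of_le (by omega)).congr fun x _ => ?_
    simp [GateFn.or, Fin.exists_fin_succ]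

/-- The conjunction of `n` given wires costs `n + 1` gates over `monConst` (fold of `∧₂` from `1`). -/
theorem lc_andFin {ι : Type*} : ∀ (n : ℕ) (w : Fin n → ι),
    CktSize monConst (fun (x : ι → Bool) (_ : Unit) => decide (∀ a, x (w a) = true)) (n + 1)
  | 0, w => (lc_cktSize_const ι true).congr fun x _ => by simp
  | n + 1, w => by
    have h1 := (CktSize.id monConst).pair (lc_andFin n fun a => w a.succ)
    have h2 := CktSize.gate (B := monConst) (ι := ι ⊕ Unit) (GateFn.and 2) lc_mem_and
      ![Sum.inl (w 0), Sum.inr ()]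
    refine ((h1.comp h2).of_le (by omega)).congr fun x _ => ?_
    simp [GateFn.and, Fin.forall_fin_succ]

/-- The disjunction of a finite family of wires costs `card + 1` gates over `monConst`. -/
theorem lc_orFintype {α ι : Type*} [Fintype α] (w : α → ι) :
    CktSize monConst (fun (x : ι → Bool) (_ : Unit) => decide (∃ a, x (w a) = true))
      (Fintype.card α + 1) :=
  (lc_orFin (Fintype.card α) fun i => w ((Fintype.equivFin α).symm i)).congr fun x _ => by
    rw [decide_eq_decide]
    exact (Equiv.exists_congr_left (p := fun a => x (w a) = true) (Fintype.equivFin α)).symm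

/-- An INFLATIONARY operator on the valuations of a finite type `κ`, iterated from the empty
valuation, is stationary after `card κ` rounds (each non-stationary round adds a point). -/
theorem lc_iterate_fix {κ : Type*} [Fintype κ] (Φ : (κ → Bool) → κ → Bool)
    (hΦ : ∀ b x, b x = true → Φ b x = true) :
    Φ^[Fintype.card κ + 1] (fun _ => false) = Φ^[Fintype.card κ] (fun _ => false) := by
  set b : ℕ → κ → Bool := fun t => Φ^[t] fun _ => false
  have hsucc : ∀ t, b (t + 1) = Φ (b t) := fun t => Function.iterate_succ_apply' Φ t _
  have hstat : ∀ t, b (t + 1) = b t → ∀ j, b (t + j) = b t := by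
    intro t ht j
    induction j with
    | zero => rfl
    | succ j ih => rw [← add_assoc, hsucc, ih, ← hsucc, ht]
  show b (Fintype.card κ + 1) = b (Fintype.card κ)
  by_contra hne
  let S : ℕ → Finset κ := fun t => univ.filter fun x => b t x = true
  have hgrow : ∀ t ≤ Fintype.card κ, (S t).card < (S (t + 1)).card := by
    intro t ht
    refine card_lt_card ⟨fun x hx => ?_, fun hsub => hne ?_⟩
    · simp only [S, mem_filter, mem_univ, true_and] at hx ⊢
      exact hsucc t ▸ hΦ _ _ hx
    · have heq : b (t + 1) = b t := by
        funext x
        refine Bool.eq_iff_iff.2 ⟨fun h => ?_, fun h => hsucc t ▸ hΦ _ _ h⟩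
        simpa [S] using hsub (by simpa [S] using h)
      have h1 := hstat t heq (Fintype.card κ - t)
      have h2 := hstat t heq (Fintype.card κ + 1 - t)
      rw [Nat.add_sub_cancel' ht] at h1
      exact ((Nat.add_sub_cancel' (Nat.le_succ_of_le ht)) ▸ h2).trans h1.symm
  have hle : ∀ t ≤ Fintype.card κ + 1, t ≤ (S t).card := by
    intro t
    induction t with
    | zero => exact fun _ => Nat.zero_le _
    | succ t ih =>
      exact fun ht => Nat.succ_le_of_lt
        ((ih (Nat.le_of_succ_le ht)).trans_lt (hgrow t (Nat.le_of_succ_le_succ ht)))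
  exact absurd ((hle _ le_rfl).trans (card_le_univ _)) (by omega)

/-! ## Facts: partial assignments with domain of size `≤ k` -/

/-- The Datalog FACTS of `k`-consistency: partial assignments `W → Fin nd` with `|W| ≤ k`
(canonical representation: a small domain together with a function on it). -/
abbrev LCFact (nv nd k : ℕ) : Type :=
  Σ W : {W : Finset (Fin nv) // W.card ≤ k}, ({x : Fin nv // x ∈ W.1} → Fin nd)

variable {nv nd k m s : ℕ}

namespace LCFact

/-- The fact `(W, h|_W)` of a total assignment `h`. -/
def ofFun (W : Finset (Fin nv)) (hW : W.card ≤ k) (h : Fin nv → Fin nd) : LCFact nv nd k :=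
  ⟨⟨W, hW⟩, fun y => h y.1⟩

/-- A total representative of a fact (extended by the default assignment `h₀`). -/
def toFun (h₀ : Fin nv → Fin nd) (F : LCFact nv nd k) : Fin nv → Fin nd :=
  fun x => if hx : x ∈ F.1.1 then F.2 ⟨x, hx⟩ else h₀ x

/-- On its domain the fact of `h` agrees with `h`. -/
theorem toFun_ofFun {h₀ : Fin nv → Fin nd} {W : Finset (Fin nv)} {hW : W.card ≤ k}
    {h : Fin nv → Fin nd} {y : Fin nv} (hy : y ∈ W) : toFun h₀ (ofFun W hW h) y = h y := dif_pos hy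

/-- Facts of assignments agreeing on the domain coincide. -/
theorem ofFun_congr {W : Finset (Fin nv)} {hW : W.card ≤ k} {h₁ h₂ : Fin nv → Fin nd}
    (H : ∀ y ∈ W, h₁ y = h₂ y) : (ofFun W hW h₁ : LCFact nv nd k) = ofFun W hW h₂ :=
  congrArg (Sigma.mk _) (funext fun y => H y.1 y.2)

/-- Extension of a fact by `x ↦ a` (`x` fresh, room left in the domain). -/
def extend (h₀ : Fin nv → Fin nd) (F : LCFact nv nd k) (x : Fin nv)
    (hx : x ∉ F.1.1 ∧ F.1.1.card < k) (a : Fin nd) : LCFact nv nd k :=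
  ofFun (insert x F.1.1) (by rw [card_insert_of_notMem hx.1]; exact hx.2)
    (Function.update (F.toFun h₀) x a)

end LCFact

/-- Codes of small sets (`i`-th smallest element, padded by `none`), bounding their number. -/
noncomputable def lcSetCode (W : {W : Finset (Fin nv) // W.card ≤ k}) (i : Fin k) :
    Option (Fin nv) :=
  if h : (i : ℕ) < W.1.card then some (W.1.orderEmbOfFin rfl ⟨i, h⟩) else none

/-- A small set is the set of values of its code. -/
theorem lc_mem_iff_setCode (W : {W : Finset (Fin nv) // W.card ≤ k}) (x : Fin nv) :
    x ∈ W.1 ↔ ∃ i, lcSetCode W i = some x := by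
  constructor
  · intro hx
    obtain ⟨j, hj⟩ : x ∈ Set.range (W.1.orderEmbOfFin rfl) := by rwa [range_orderEmbOfFin]
    exact ⟨⟨j, j.2.trans_le W.2⟩, by simp [lcSetCode, j.2, hj]⟩
  · rintro ⟨i, hi⟩
    unfold lcSetCode at hi
    split_ifs at hi with h
    exact Option.some.inj hi ▸ orderEmbOfFin_mem _ _ _

/-- There are at most `(nv + 1) ^ k ≤ s` domains (if some assignment `h₀` exists at all). -/
theorem lc_card_smallSets (h₀ : Fin nv → Fin nd) (hk : (nv * nd + 1) ^ k ≤ s) :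
    Fintype.card {W : Finset (Fin nv) // W.card ≤ k} ≤ s := by
  have hinj : Function.Injective (lcSetCode (nv := nv) (k := k)) := fun W₁ W₂ h =>
    Subtype.ext (Finset.ext fun x => by rw [lc_mem_iff_setCode, lc_mem_iff_setCode, h])
  refine (Fintype.card_le_of_injective _ hinj).trans ?_
  simp only [Fintype.card_fun, Fintype.card_fin, Fintype.card_option]
  refine (Nat.pow_le_pow_left ?_ k).trans hk
  rcases Nat.eq_zero_or_pos nv with rfl | hnv
  · simp
  · exact Nat.succ_le_succ (Nat.le_mul_of_pos_right nv (Fin.pos (h₀ ⟨0, hnv⟩)))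

/-- There are at most `s²` facts. -/
theorem lc_card_fact (h₀ : Fin nv → Fin nd) (hk : (nv * nd + 1) ^ k ≤ s) :
    Fintype.card (LCFact nv nd k) ≤ s * s := by
  rw [Fintype.card_sigma]
  have hW (W : {W : Finset (Fin nv) // W.card ≤ k}) : Fintype.card ({x // x ∈ W.1} → Fin nd) ≤ s := by
    rw [Fintype.card_fun, Fintype.card_fin, Fintype.card_coe]
    rcases Nat.eq_zero_or_pos nv with rfl | hnv
    · rw [Finset.eq_empty_of_isEmpty W.1, card_empty, pow_zero]
      exact (Nat.one_le_pow _ _ (Nat.succ_pos _)).trans hk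
    · calc nd ^ W.1.card ≤ (nv * nd + 1) ^ W.1.card :=
            Nat.pow_le_pow_left ((Nat.le_mul_of_pos_left nd hnv).trans (Nat.le_succ _)) _
        _ ≤ (nv * nd + 1) ^ k := Nat.pow_le_pow_right (Nat.succ_pos _) W.2
        _ ≤ s := hk
  calc ∑ W, Fintype.card ({x // x ∈ W.1} → Fin nd)
      ≤ ∑ _W : {W : Finset (Fin nv) // W.card ≤ k}, s := sum_le_sum fun W _ => hW W
    _ = Fintype.card {W : Finset (Fin nv) // W.card ≤ k} * s := by simp
    _ ≤ s * s := Nat.mul_le_mul_right _ (lc_card_smallSets h₀ hk)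

/-! ## The round operator, its soundness and completeness -/

section Round

variable (U : Fin m → Finset (Fin nv)) (R : Fin m → (Fin nv → Fin nd) → Prop) (v : Fin m → Bool)
  (h₀ : Fin nv → Fin nd)

open Classical in
/-- One ROUND of the `k`-consistency closure on fact valuations `b` (selection `v`): a fact holds
after the round iff it held, or it violates a present constraint inside its domain (`viol`), or
some fresh variable has all its extensions holding (`ext`), or a sub-fact holds (`mono`/`congr`). -/
noncomputable def lcStepB (b : LCFact nv nd k → Bool) (F : LCFact nv nd k) : Bool :=
  decide (b F = true ∨ (∃ j, (U j ⊆ F.1.1 ∧ ¬ R j (F.toFun h₀)) ∧ v j = true) ∨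
    (∃ x, ∃ hx : x ∉ F.1.1 ∧ F.1.1.card < k, ∀ a, b (F.extend h₀ x hx a) = true) ∨
    ∃ F' : LCFact nv nd k, (F'.1.1 ⊆ F.1.1 ∧ ∀ y ∈ F'.1.1, F'.toFun h₀ y = F.toFun h₀ y) ∧ b F' = true)

/-- The four ways a fact holds after a round. -/
theorem lcStepB_eq_true_iff {b : LCFact nv nd k → Bool} {F : LCFact nv nd k} :
    lcStepB U R v h₀ b F = true ↔ b F = true ∨
      (∃ j, (U j ⊆ F.1.1 ∧ ¬ R j (F.toFun h₀)) ∧ v j = true) ∨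
      (∃ x, ∃ hx : x ∉ F.1.1 ∧ F.1.1.card < k, ∀ a, b (F.extend h₀ x hx a) = true) ∨
      ∃ F' : LCFact nv nd k,
        (F'.1.1 ⊆ F.1.1 ∧ ∀ y ∈ F'.1.1, F'.toFun h₀ y = F.toFun h₀ y) ∧ b F' = true := by
  simp only [lcStepB, decide_eq_true_eq]

/-- `t` rounds from the empty valuation. -/
noncomputable def lcIter (t : ℕ) : LCFact nv nd k → Bool :=
  (lcStepB U R v h₀)^[t] fun _ => false

/-- **Soundness of the rounds**: every fact holding after `t` rounds is derivably inconsistent. -/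
theorem lc_sound (t : ℕ) : ∀ F : LCFact nv nd k, lcIter U R v h₀ t F = true →
    KInconsistent nv nd k U R v F.1.1 (F.toFun h₀) := by
  induction t with
  | zero => intro F hF; simp [lcIter] at hF
  | succ t ih =>
    intro F hF
    rw [lcIter, Function.iterate_succ_apply', lcStepB_eq_true_iff] at hF
    rcases hF with h | ⟨j, ⟨hU, hR⟩, hj⟩ | ⟨x, hx, hall⟩ | ⟨F', hsub, hF'⟩
    · exact ih F h
    · exact .viol hj hU F.1.2 hR
    · exact .ext x hx.2 hx.1 fun a =>
        .congr (fun y hy => (LCFact.toFun_ofFun hy).symm) (ih _ (hall a))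
    · exact .mono hsub.1 F.1.2 (.congr (fun y hy => (hsub.2 y hy).symm) (ih F' hF'))

/-- After `|LCFact|` rounds the valuation is a prefixed point of the round operator. -/
theorem lc_prefixed {F : LCFact nv nd k}
    (h : lcStepB U R v h₀ (lcIter U R v h₀ (Fintype.card (LCFact nv nd k))) F = true) :
    lcIter U R v h₀ (Fintype.card (LCFact nv nd k)) F = true := by
  have hfix := lc_iterate_fix (lcStepB (k := k) U R v h₀) fun b F hF =>
    (lcStepB_eq_true_iff U R v h₀).2 (Or.inl hF)
  rw [lcIter, ← hfix, Function.iterate_succ_apply']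
  exact h

/-- **Completeness of the rounds**: every derivably inconsistent `(W, h)` holds, as the fact
`(W, h|_W)`, after `|LCFact|` rounds (the derivable facts are the LEAST set closed under the
rules, and the prefixed point is closed under them). -/
theorem lc_complete (hR : ∀ j h h', (∀ y ∈ U j, h' y = h y) → (R j h ↔ R j h'))
    {W : Finset (Fin nv)} {h : Fin nv → Fin nd} (hd : KInconsistent nv nd k U R v W h) :
    ∀ hW : W.card ≤ k,
      lcIter U R v h₀ (Fintype.card (LCFact nv nd k)) (LCFact.ofFun W hW h) = true := by
  induction hd with
  | @viol j W h hv hU _ hRj =>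
    refine fun hW => lc_prefixed U R v h₀ ((lcStepB_eq_true_iff U R v h₀).2
      (Or.inr (Or.inl ⟨j, ⟨hU, fun hR' => hRj ?_⟩, hv⟩)))
    exact (hR j _ h fun y hy => (LCFact.toFun_ofFun (hU hy)).symm).1 hR'
  | @ext W h x hWk hx _ ih =>
    refine fun hW => lc_prefixed U R v h₀ ((lcStepB_eq_true_iff U R v h₀).2
      (Or.inr (Or.inr (Or.inl ⟨x, ⟨hx, hWk⟩, fun a => ?_⟩))))
    show lcIter U R v h₀ _ (LCFact.ofFun (insert x W) _
      (Function.update ((LCFact.ofFun W hW h).toFun h₀) x a)) = true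
    rw [LCFact.ofFun_congr (h₂ := Function.update h x a)]
    · exact ih a _
    · intro y hy
      rcases mem_insert.1 hy with rfl | hy
      · simp
      · rw [Function.update_of_ne (ne_of_mem_of_not_mem hy hx),
          Function.update_of_ne (ne_of_mem_of_not_mem hy hx), LCFact.toFun_ofFun hy]
  | @mono W W' h hWW' hW'k _ ih =>
    exact fun hW' => lc_prefixed U R v h₀ ((lcStepB_eq_true_iff U R v h₀).2
      (Or.inr (Or.inr (Or.inr ⟨LCFact.ofFun W ((card_le_card hWW').trans hW'k) h,
        ⟨hWW', fun y hy => by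
          rw [LCFact.toFun_ofFun (W := W) hy, LCFact.toFun_ofFun (W := W') (hWW' hy)]⟩,
        ih _⟩))))
  | @congr W h h' hh' _ ih =>
    intro hW
    rw [LCFact.ofFun_congr hh']
    exact ih hW

/-- The gate semantics: the selected instance is refuted iff the empty fact holds after
`|LCFact|` rounds. -/
theorem lc_output (hR : ∀ j h h', (∀ y ∈ U j, h' y = h y) → (R j h ↔ R j h')) :
    (∀ h, KInconsistent nv nd k U R v ∅ h) ↔
      lcIter U R v h₀ (Fintype.card (LCFact nv nd k)) (LCFact.ofFun (k := k) ∅ (by simp) h₀) = true :=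
  ⟨fun H => lc_complete U R v h₀ hR (H h₀) _, fun H _ =>
    .congr (fun y hy => absurd hy (notMem_empty y)) (lc_sound U R v h₀ _ _ H)⟩

/-! ## The circuit: one round is `poly(s)` binary gates -/

/-- One round at one fact, as a single-output `monConst`-circuit on the wires
`inputs ⊕ facts`: an `∨` (`lc_orFintype`) of the fact's own wire, the input wires of the
constraints it violates, the `∧`s (`lc_andFin`) over the values of each fresh variable, and the
wires of its sub-facts. -/
theorem lc_stepCkt (F : LCFact nv nd k) :
    CktSize monConst (fun (y : Fin m ⊕ LCFact nv nd k → Bool) (_ : Unit) =>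
      lcStepB U R (fun j => y (.inl j)) h₀ (fun F' => y (.inr F')) F)
      (nv * (nd + 1) + (m + nv + Fintype.card (LCFact nv nd k) + 2)) := by
  classical
  have h1 : CktSize monConst (fun (y : Fin m ⊕ LCFact nv nd k → Bool) => Sum.elim y
      fun x : {x : Fin nv // x ∉ F.1.1 ∧ F.1.1.card < k} =>
        decide (∀ a : Fin nd, y (.inr (F.extend h₀ x.1 x.2 a)) = true))
      (0 + Fintype.card {x : Fin nv // x ∉ F.1.1 ∧ F.1.1.card < k} * (nd + 1)) :=
    (CktSize.id monConst).pair
      (CktSize.pi_const fun x => lc_andFin nd fun a => Sum.inr (F.extend h₀ x.1 x.2 a))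
  have h2 := lc_orFintype
    (ι := (Fin m ⊕ LCFact nv nd k) ⊕ {x : Fin nv // x ∉ F.1.1 ∧ F.1.1.card < k})
    (Sum.elim (fun _ : Unit => Sum.inl (Sum.inr F))
      (Sum.elim (fun j : {j : Fin m // U j ⊆ F.1.1 ∧ ¬ R j (F.toFun h₀)} => Sum.inl (Sum.inl j.1))
        (Sum.elim (fun x : {x : Fin nv // x ∉ F.1.1 ∧ F.1.1.card < k} => Sum.inr x)
          (fun F' : {F' : LCFact nv nd k // F'.1.1 ⊆ F.1.1 ∧
            ∀ y ∈ F'.1.1, F'.toFun h₀ y = F.toFun h₀ y} => Sum.inl (Sum.inr F'.1)))))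
  refine ((h1.comp h2).of_le ?_).congr fun y _ => ?_
  · have hX := Fintype.card_subtype_le fun x : Fin nv => x ∉ F.1.1 ∧ F.1.1.card < k
    have hJ := Fintype.card_subtype_le fun j : Fin m => U j ⊆ F.1.1 ∧ ¬ R j (F.toFun h₀)
    have hS := Fintype.card_subtype_le fun F' : LCFact nv nd k =>
      F'.1.1 ⊆ F.1.1 ∧ ∀ y ∈ F'.1.1, F'.toFun h₀ y = F.toFun h₀ y
    simp only [Fintype.card_fin, Fintype.card_sum, Fintype.card_unit] at hX hJ ⊢
    have := Nat.mul_le_mul_right (nd + 1) hX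
    omega
  · rw [Bool.eq_iff_iff, lcStepB_eq_true_iff, decide_eq_true_iff]
    simp only [Sum.exists, Subtype.exists, Sum.elim_inl, Sum.elim_inr, exists_prop, exists_const,
      decide_eq_true_eq]

/-- The round as an endo-map of the wires `inputs ⊕ facts` (inputs copied through). -/
noncomputable def lcRound (y : Fin m ⊕ LCFact nv nd k → Bool) : Fin m ⊕ LCFact nv nd k → Bool :=
  Sum.elim (fun j => y (.inl j)) (lcStepB U R (fun j => y (.inl j)) h₀ fun F' => y (.inr F'))

/-- Iterating the wire map iterates the round operator on the fact wires. -/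
theorem lc_round_iterate (t : ℕ) (b : LCFact nv nd k → Bool) :
    (lcRound U R h₀)^[t] (Sum.elim v b) = Sum.elim v ((lcStepB U R v h₀)^[t] b) := by
  induction t generalizing b with
  | zero => rfl
  | succ t ih =>
    rw [Function.iterate_succ_apply, Function.iterate_succ_apply]
    exact ih _

end Round

/-- **Stub 1 — `ConsistencyUnrolls`** (registered stub `stub_consistencyUnrolls` of the line
`csp-spine-meet-to-join`): every LC gate of size parameter `s` is computed by a
`{∧₂, ∨₂, 1, 0}`-circuit with `≤ (s + 2) ^ 10` gates — `|LCFact| ≤ s²` rounds (`CktSize.iterate`)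
of the round circuit (`lc_stepCkt`, bundled by `CktSize.pi_const`) from the all-`0` valuation,
reading off the empty fact (`lc_output`). Degenerate case `nd = 0 < nv`: the gate is constant `1`. -/
theorem stub_consistencyUnrolls : ∃ c : ℕ, ∀ (s : ℕ) (g : GateFn), IsLCGate s g →
    ∃ C : Circuit (Fin g.1), C.IsOver monConst ∧ C.size ≤ (s + 2) ^ c ∧ C.Computes g.2 := by
  refine ⟨10, fun s g hg => ?_⟩
  obtain ⟨hm, nv, nd, k, hnv, hnd, hk, U, R, -, hR, hiff⟩ := hg
  have hT2 : 2 ≤ s + 2 := by omega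
  by_cases hne : Nonempty (Fin nv → Fin nd)
  swap
  · -- degenerate case: there is no assignment at all, the gate is constantly `1`
    obtain ⟨C, hC, hCs, hCe⟩ := (lc_cktSize_const (Fin g.1) true).toCircuit
    exact ⟨C, hC, hCs.trans (Nat.one_le_pow _ _ (by omega)), fun x =>
      (hCe x).trans ((hiff x).2 fun h => (hne ⟨h⟩).elim).symm⟩
  obtain ⟨h₀⟩ := hne
  set N := Fintype.card (LCFact nv nd k) with hN
  have hinit : CktSize monConst
      (fun (v : Fin g.1 → Bool) => Sum.elim v fun (_ : LCFact nv nd k) => false) (0 + 1) :=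
    (CktSize.id monConst).pair ((lc_cktSize_const (Fin g.1) false).outMap fun _ => ())
  have hround : CktSize monConst (lcRound U R h₀)
      (0 + N * (nv * (nd + 1) + (g.1 + nv + N + 2))) :=
    (CktSize.proj monConst Sum.inl).pair (CktSize.pi_const (lc_stepCkt U R h₀))
  obtain ⟨C, hC, hCs, hCe⟩ := ((hinit.comp (hround.iterate N)).outMap
    fun _ : Unit => Sum.inr (LCFact.ofFun (k := k) ∅ (by simp) h₀)).toCircuit
  refine ⟨C, hC, hCs.trans ?_, fun v => (hCe v).trans ?_⟩
  · -- size `1 + N · N · (nv (nd + 1) + m + nv + N + 2) ≤ 2 (s + 2) ^ 7 ≤ (s + 2) ^ 10`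
    have hNs : N ≤ s * s := lc_card_fact h₀ hk
    have hN2 : N ≤ (s + 2) ^ 2 :=
      hNs.trans (by rw [pow_two]; exact Nat.mul_le_mul (by omega) (by omega))
    have h3 : nv * (nd + 1) + (g.1 + nv + N + 2) ≤ (s + 2) ^ 3 :=
      calc nv * (nd + 1) + (g.1 + nv + N + 2)
          ≤ (s + 2) * (s + 2) + (s + 2) * (s + 2) :=
            add_le_add (Nat.mul_le_mul (by omega) (by omega)) (by nlinarith)
        _ = 2 * (s + 2) ^ 2 := by ring
        _ ≤ (s + 2) * (s + 2) ^ 2 := Nat.mul_le_mul_right _ hT2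
        _ = (s + 2) ^ 3 := by ring
    calc 0 + 1 + N * (0 + N * (nv * (nd + 1) + (g.1 + nv + N + 2)))
        ≤ (s + 2) ^ 7 + (s + 2) ^ 2 * ((s + 2) ^ 2 * (s + 2) ^ 3) := by
          rw [Nat.zero_add, Nat.zero_add]
          exact add_le_add (Nat.one_le_pow _ _ (by omega))
            (Nat.mul_le_mul hN2 (Nat.mul_le_mul hN2 h3))
      _ = 2 * (s + 2) ^ 7 := by ring
      _ ≤ (s + 2) * (s + 2) ^ 7 := Nat.mul_le_mul_right _ hT2
      _ = (s + 2) ^ 8 := by ring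
      _ ≤ (s + 2) ^ 10 := Nat.pow_le_pow_right (by omega) (by omega)
  · -- semantics
    show ((lcRound U R h₀)^[N] (Sum.elim v fun _ => false)) (Sum.inr _) = g.2 v
    rw [lc_round_iterate, Sum.elim_inr, Bool.eq_iff_iff, hiff, lc_output U R v h₀ hR]
    rfl

end Summit.PneNP.PneNP.Cruxes.Capture.CspSpineMeetToJoin
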